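import Literature.AlgebraicGeometry.Motives.HodgeImaginaryQuadraticRankFourExtraEndomorphisms
import HarnessLib

/-!
# A weight-one Hodge structure on which an imaginary quadratic field acts with PURE signature `(m, 0)` has a
non-zero, non-invertible Hodge endomorphism (Shimura 1963, Prop. 14: multiplicities `(g, 0)` do not occur on a
simple abelian variety of dimension `g ≥ 2`)

Family `hodge`, layer `Literature/AlgebraicGeometry/Motives` (pure Hodge theory; no abelian varieties in this
file). Research context: cell `pub-hodge-ring2` (HONEST FRAMING: research route conditional on HC_CM; not a
corollary; Q11.4-sentence-2 already refuted in dim ≥ 3), Literature lane, programme R12 «simple abelian surfaces /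
Shimura's exceptional cases», companion of `HodgeImaginaryQuadraticRankFourExtraEndomorphisms` (rank four, both
signatures). THEOREMS ONLY: no named fact, no definition, no `sorry`.

THE PRINTED STATEMENT. Moonen–Zarhin 1999 (2.5), proof: "if `g = 3` and `End⁰(X) = F` is imaginary quadratic
(Type IV(1,1)), `F` necessarily acts on the tangent space with multiplicities `(2,1)`. (An action with
multiplicities `(3,0)` is excluded; see [Shimura 1963], Proposition 14.)" Hulek–Laface 2019 Prop. 5.1, the first
exceptional case of Shimura's theorem "`F` of type IV, `∑ r_ν s_ν = 0`", and its proof: "under the assumption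
that our abelian variety `X` be simple, one can show that these cases never occur: … `X` is isogenous to
`Y^{…}` …". In Hodge-theoretic terms (this file, any rank): let `(V, H)` be an effective weight-one `ℚ`-Hodge
structure, `φ ∈ End_Hdg(V)` with `φ² = -d`, `d > 0` (so `K = ℚ[φ] ≅ ℚ(√-d)` acts), `μ = ±i√d`, and suppose the
signature is PURE: `V^{1,0} ∩ W_{-μ} = 0` (`W_{±μ}` the eigenspaces of `φ_ℂ`; multiplicities `(m, 0)`,
`m = dim V^{1,0}`). Then `V^{1,0} = W_μ` (the tree's `ImaginaryQuadraticRankFour.piece_eq_eigenspace`, which is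
rank-free), so EVERY `K`-linear rational operator is a Hodge endomorphism
(`ImaginaryQuadraticRankFour.mem_endAlg_of_commute`); and as soon as `dim_ℚ V ≥ 3` there is a `K`-linear
operator of `K`-rank one — `u_{β,v}(x) = β(φx)·v + β(x)·φv` for a functional `β` and a vector `v` — which is
non-zero and not invertible. Hence `End_Hdg(V)` is not a division algebra; for `V = H¹(A; ℚ)` of an abelian
variety `A` this says `A` is not simple (the geometric reading is `HodgeTheory/…`, via Riemann's
`End_Hdg(H¹) ≅ End⁰(A)ᵒᵖ` and Mumford §19 Cor. 2).

* §1 `ImaginaryQuadratic.kRankOne_comm` (`u_{β,v}` commutes with `φ`), `kRankOne_apply_mem_span` (its image lies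
  in `ℚv + ℚφv`), `kRankOne_ne_zero`, `not_isUnit_kRankOne` (`dim V ≥ 3`),
  `exists_comm_ne_zero_not_isUnit`.
* §2 MAIN: **`ImaginaryQuadratic.exists_mem_endAlg_ne_zero_not_isUnit`** — pure signature and `dim_ℚ V ≥ 3` give
  `u ∈ End_Hdg(V)`, `u ≠ 0`, `¬ IsUnit u`; `not_forall_mem_endAlg_isUnit`.

## References
* [MoonenZarhin1999LowDim] B. Moonen, Yu. Zarhin, Math. Ann. 315 (1999) 711–733, (2.5) and its proof (p. 715:
  "multiplicities `(3,0)` excluded; see [Shimura], Proposition 14").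
* [Shimura1963AnalyticFamilies] G. Shimura, Ann. of Math. 78 (1963) 149–192, §4 Prop. 14 (read through
  Moonen–Zarhin (2.5) and Hulek–Laface Prop. 5.1).
* [HulekLaface2019PicardNumbersAV] K. Hulek, R. Laface, Ann. Sc. Norm. Super. Pisa (5) 19 (2019), Prop. 5.1, first
  exceptional case and proof (arXiv:1703.05882, p. 10).
* [Deligne1982HodgeCycles] P. Deligne, LNM 900 (1982), §4 p. 30 (`H¹ ⊗ ℂ = ⊕_σ H¹_σ`).
-/

noncomputable section

open scoped TensorProduct

namespace Literature.AlgebraicGeometry.Motives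

namespace HodgeStructure

universe u

variable {V : Type u} [AddCommGroup V] [Module ℚ V]

/-! ### §1 The `K`-rank-one operators `u_{β,v}(x) = β(φx)·v + β(x)·φv` -/

section Algebra

/-- `v ≠ 0 ⟹ v, φ v` linearly independent (`φ² = -d < 0` has no rational eigenvalue). [folklore] -/
private theorem ImaginaryQuadratic.linearIndependent_pair {φ : Module.End ℚ V} {d : ℚ} (hd : 0 < d)
    (hφ2 : φ * φ = -(d • 1)) {v : V} (hv : v ≠ 0) : LinearIndependent ℚ ![v, φ v] := by
  rw [LinearIndependent.pair_iff]
  intro s t hst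
  have hφφ : φ (φ v) = -(d • v) := by
    have h := LinearMap.congr_fun hφ2 v
    rwa [Module.End.mul_apply, LinearMap.neg_apply, LinearMap.smul_apply, Module.End.one_apply] at h
  by_cases ht : t = 0
  · subst ht
    rw [zero_smul, add_zero, smul_eq_zero] at hst
    exact ⟨hst.resolve_right hv, rfl⟩
  · exfalso
    have hφv : φ v = (-(s / t)) • v := by
      have h : t • φ v = -(s • v) := eq_neg_of_add_eq_zero_right hst
      calc φ v = t⁻¹ • (t • φ v) := by rw [smul_smul, inv_mul_cancel₀ ht, one_smul]
        _ = _ := by rw [h, smul_neg, smul_smul, neg_smul, div_eq_inv_mul]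
    have hsq : ((s / t) ^ 2 + d) • v = 0 := by
      have h := hφφ
      rw [hφv, map_smul, hφv, smul_smul, neg_mul_neg, ← sq] at h
      rw [add_smul, h, neg_add_cancel]
    rcases smul_eq_zero.1 hsq with h | h
    · have : (0 : ℚ) < (s / t) ^ 2 + d := by positivity
      exact this.ne' h
    · exact hv h

/-- `φ (φ x) = -d x`. [folklore] -/
private theorem ImaginaryQuadratic.apply_apply {φ : Module.End ℚ V} {d : ℚ} (hφ2 : φ * φ = -(d • 1))
    (x : V) : φ (φ x) = -(d • x) := by
  have h := LinearMap.congr_fun hφ2 x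
  rwa [Module.End.mul_apply, LinearMap.neg_apply, LinearMap.smul_apply, Module.End.one_apply] at h

/-- **`u_{β,v}` is `ℚ[φ]`-linear**: the operator `x ↦ β(φx)·v + β(x)·φv` commutes with `φ` (both composites send
`x` to `β(φx)·φv - d·β(x)·v`). Hulek–Laface, proof of Prop. 5.1: the `K`-linear maps of `V ≅ K^m`.
[cite: HulekLaface2019PicardNumbersAV, Prop. 5.1 (proof)] [cite: Deligne1982HodgeCycles, §4 (p. 30)] -/
theorem ImaginaryQuadratic.kRankOne_comm {φ : Module.End ℚ V} {d : ℚ} (hφ2 : φ * φ = -(d • 1))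
    (β : Module.Dual ℚ V) (v : V) :
    ((β ∘ₗ φ).smulRight v + β.smulRight (φ v)) * φ = φ * ((β ∘ₗ φ).smulRight v + β.smulRight (φ v)) := by
  refine LinearMap.ext fun x => ?_
  simp only [Module.End.mul_apply, LinearMap.add_apply, LinearMap.smulRight_apply, LinearMap.coe_comp,
    Function.comp_apply, map_add, map_smul, ImaginaryQuadratic.apply_apply hφ2, map_neg, smul_neg, neg_smul,
    smul_eq_mul, mul_smul]
  rw [smul_comm (β x) d (v : V), add_comm]

/-- The image of `u_{β,v}` lies in the plane `ℚv + ℚφv`. [cite: HulekLaface2019PicardNumbersAV, Prop. 5.1 (proof)] -/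
theorem ImaginaryQuadratic.kRankOne_apply_mem_span (φ : Module.End ℚ V) (β : Module.Dual ℚ V) (v x : V) :
    ((β ∘ₗ φ).smulRight v + β.smulRight (φ v)) x ∈ Submodule.span ℚ (Set.range ![v, φ v]) := by
  rw [LinearMap.add_apply, LinearMap.smulRight_apply, LinearMap.smulRight_apply]
  refine Submodule.add_mem _ (Submodule.smul_mem _ _ (Submodule.subset_span ⟨0, rfl⟩))
    (Submodule.smul_mem _ _ (Submodule.subset_span ⟨1, rfl⟩))

/-- `u_{β,v} ≠ 0` when `β v ≠ 0` (its value at `v` has `φv`-coordinate `β v`).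
[cite: HulekLaface2019PicardNumbersAV, Prop. 5.1 (proof)] -/
theorem ImaginaryQuadratic.kRankOne_ne_zero {φ : Module.End ℚ V} {d : ℚ} (hd : 0 < d) (hφ2 : φ * φ = -(d • 1))
    {β : Module.Dual ℚ V} {v : V} (hβv : β v ≠ 0) :
    (β ∘ₗ φ).smulRight v + β.smulRight (φ v) ≠ 0 := by
  have hv : v ≠ 0 := fun h => hβv (by rw [h, map_zero])
  intro hu
  have h := LinearMap.congr_fun hu v
  rw [LinearMap.add_apply, LinearMap.smulRight_apply, LinearMap.smulRight_apply, LinearMap.coe_comp,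
    Function.comp_apply, LinearMap.zero_apply] at h
  have hli := ImaginaryQuadratic.linearIndependent_pair hd hφ2 hv
  have h2 := (LinearIndependent.pair_iff.1 hli) (β (φ v)) (β v) h
  exact hβv h2.2

/-- `u_{β,v}` is not invertible when `dim_ℚ V ≥ 3` (its image lies in a plane).
[cite: HulekLaface2019PicardNumbersAV, Prop. 5.1 (proof)] -/
theorem ImaginaryQuadratic.not_isUnit_kRankOne [Module.Finite ℚ V] (φ : Module.End ℚ V) (β : Module.Dual ℚ V)
    (v : V) (hV : 3 ≤ Module.finrank ℚ V) : ¬ IsUnit ((β ∘ₗ φ).smulRight v + β.smulRight (φ v)) := by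
  intro hu
  have hsurj := ((Module.End.isUnit_iff _).1 hu).2
  have htop : (⊤ : Submodule ℚ V) ≤ Submodule.span ℚ (Set.range ![v, φ v]) := by
    intro x _
    obtain ⟨y, rfl⟩ := hsurj x
    exact ImaginaryQuadratic.kRankOne_apply_mem_span φ β v y
  have h1 : Module.finrank ℚ (⊤ : Submodule ℚ V) ≤ Module.finrank ℚ (Submodule.span ℚ (Set.range ![v, φ v])) :=
    Submodule.finrank_mono htop
  have h2 : Module.finrank ℚ (Submodule.span ℚ (Set.range ![v, φ v])) ≤ 2 :=
    (finrank_range_le_card _).trans (by simp)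
  rw [finrank_top] at h1
  omega

/-- **A non-zero, non-invertible `ℚ[φ]`-linear operator exists when `dim_ℚ V ≥ 3`** (`V ≅ K^m`, `m ≥ 2`, is not
a simple `K`-module). [cite: HulekLaface2019PicardNumbersAV, Prop. 5.1 (proof)] -/
theorem ImaginaryQuadratic.exists_comm_ne_zero_not_isUnit [Module.Finite ℚ V] {φ : Module.End ℚ V} {d : ℚ}
    (hd : 0 < d) (hφ2 : φ * φ = -(d • 1)) (hV : 3 ≤ Module.finrank ℚ V) :
    ∃ u : Module.End ℚ V, u * φ = φ * u ∧ u ≠ 0 ∧ ¬ IsUnit u := by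
  haveI : Nontrivial V := Module.nontrivial_of_finrank_pos (R := ℚ) (by omega)
  obtain ⟨v, hv⟩ := exists_ne (0 : V)
  obtain ⟨β, hβv⟩ : ∃ β : Module.Dual ℚ V, β v ≠ 0 := by
    by_contra h
    simp only [not_exists, not_not] at h
    exact hv ((Module.forall_dual_apply_eq_zero_iff ℚ v).1 h)
  exact ⟨_, ImaginaryQuadratic.kRankOne_comm hφ2 β v, ImaginaryQuadratic.kRankOne_ne_zero hd hφ2 hβv,
    ImaginaryQuadratic.not_isUnit_kRankOne φ β v hV⟩

end Algebra

/-! ### §2 Pure signature: every `ℚ[φ]`-linear operator is a Hodge endomorphism -/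

section Hodge

variable {n : ℤ}

/-- **Shimura's Prop. 14 on the Hodge structure (any rank).** Let `H` be an effective weight-one `ℚ`-Hodge
structure on `V`, `φ ∈ End_Hdg(V)` with `φ² = -d`, `d > 0`, `μ² = -d`, and suppose the signature is pure:
`V^{1,0} ∩ W_{-μ} = 0`. If `dim_ℚ V ≥ 3` then `End_Hdg(V)` contains a non-zero non-invertible element (so it is
not a division algebra): `V^{1,0} = W_μ` (`piece_eq_eigenspace`), every `ℚ[φ]`-linear operator preserves `W_μ`
(`mem_endAlg_of_commute`), and `u_{β,v}` is one of `K`-rank one. Moonen–Zarhin (2.5): "an action with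
multiplicities `(3,0)` is excluded"; Hulek–Laface Prop. 5.1: the case `∑ r_ν s_ν = 0` forces `X ∼ Y^{…}`.
[cite: MoonenZarhin1999LowDim, (2.5) (proof, p. 715)] [cite: Shimura1963AnalyticFamilies, §4 Prop. 14]
[cite: HulekLaface2019PicardNumbersAV, Prop. 5.1, first exceptional case and proof] -/
theorem ImaginaryQuadratic.exists_mem_endAlg_ne_zero_not_isUnit [Module.Finite ℚ V] (H : HodgeStructure V n)
    (hn : n = 1) (heff : H.IsEffective) {φ : Module.End ℚ V} (hφE : φ ∈ H.endAlg) {d : ℚ} (hd : 0 < d)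
    (hφ2 : φ * φ = -(d • 1)) {μ : ℂ} (hμ : μ ^ 2 = -(d : ℂ))
    (hA : H.piece 1 0 ⊓ Module.End.eigenspace (φ.baseChange ℂ) (-μ) = ⊥) (hV : 3 ≤ Module.finrank ℚ V) :
    ∃ u ∈ H.endAlg, u ≠ 0 ∧ ¬ IsUnit u := by
  have hP := ImaginaryQuadraticRankFour.piece_eq_eigenspace H hn heff hφE hd hφ2 hμ hA
  obtain ⟨u, hcomm, hu0, hnu⟩ := ImaginaryQuadratic.exists_comm_ne_zero_not_isUnit hd hφ2 hV
  exact ⟨u, ImaginaryQuadraticRankFour.mem_endAlg_of_commute H hn heff hP hcomm, hu0, hnu⟩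

/-- Contrapositive packaging: under pure signature and `dim_ℚ V ≥ 3`, `End_Hdg(V)` is NOT a division algebra.
[cite: MoonenZarhin1999LowDim, (2.5) (proof, p. 715)] [cite: Shimura1963AnalyticFamilies, §4 Prop. 14] -/
theorem ImaginaryQuadratic.not_forall_mem_endAlg_isUnit [Module.Finite ℚ V] (H : HodgeStructure V n)
    (hn : n = 1) (heff : H.IsEffective) {φ : Module.End ℚ V} (hφE : φ ∈ H.endAlg) {d : ℚ} (hd : 0 < d)
    (hφ2 : φ * φ = -(d • 1)) {μ : ℂ} (hμ : μ ^ 2 = -(d : ℂ))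
    (hA : H.piece 1 0 ⊓ Module.End.eigenspace (φ.baseChange ℂ) (-μ) = ⊥) (hV : 3 ≤ Module.finrank ℚ V) :
    ¬ ∀ u ∈ H.endAlg, u ≠ 0 → IsUnit u := by
  obtain ⟨u, huE, hu0, hnu⟩ := ImaginaryQuadratic.exists_mem_endAlg_ne_zero_not_isUnit H hn heff hφE hd hφ2 hμ hA hV
  exact fun h => hnu (h u huE hu0)

end Hodge

end HodgeStructure

end Literature.AlgebraicGeometry.Motives
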